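import Summits.KontsevichZagierPeriods.Statement
import Literature.NumberTheory.Transcendental.KZExpCalculus

/-!
# Route KontsevichZagierPeriods/ExpConservative — assembly

Two elementary implications closing the "last step" items of the structural routes:

* `Literature.Periods.kzKernelConjecture_imp` (settles stmt-KontsevichZagierPeriods-0197): the kernel form
  `KZKernelConjecture` (every formal combination with value `0` is a relation) implies the summit
  `KontsevichZagierPeriods` (= `KZPeriodConjecture`, two rational-shape representations with equal
  values are equivalent): `eval ([r] - [r']) = value r - value r' = 0`.
* `Literature.KZexp.kernelConjecture_and_conservative_imp` (settles stmt-KontsevichZagierPeriods-0529): the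
  exponential kernel conjecture together with conservativity of the exponential calculus over the
  ordinary one implies the summit, via `Literature.NumberTheory.Transcendental.KZexp.kzKernelConjecture_of_conservative`
  (`KZExpCalculus.lean`) and the previous implication.

Both hypotheses are OPEN conjectures (route theses); these are conditional results only.

Sources: M. Kontsevich, D. Zagier, *Periods* (2001), §1.2 (Conjecture 1 and its kernel
reformulation), §4.3 (exponential periods); A. Huber, S. Müller-Stach, *Periods and Nori Motives*
(2017), §13.1.
-/

namespace Literature

/-- Settles stmt-KontsevichZagierPeriods-0197: the kernel form of the period conjecture for the
KZ calculus implies the two-representation (KZ-literal) form. If `value r = value r'` then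
`eval ([r] - [r']) = 0`, so `[r] - [r'] ∈ relations`, i.e. `KZ.Equivalent r r'`; the rationality
hypotheses are not used. [Kontsevich–Zagier 2001, §1.2] [folklore] -/
theorem Periods.kzKernelConjecture_imp (hK : Literature.NumberTheory.Transcendental.KZKernelConjecture) :
    KontsevichZagierPeriods := by
  intro n m r r' _ _ hv
  show Literature.NumberTheory.Transcendental.KZ.of r - Literature.NumberTheory.Transcendental.KZ.of r' ∈ Literature.NumberTheory.Transcendental.KZ.relations
  apply hK
  rw [map_sub, Literature.NumberTheory.Transcendental.KZ.eval_of, Literature.NumberTheory.Transcendental.KZ.eval_of, hv, sub_self]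

/-- Settles stmt-KontsevichZagierPeriods-0529 (route ExpConservative, assembly): the exponential
kernel conjecture `KZexp.KernelConjecture` and conservativity `KZexp.Conservative` of the
exponential calculus over the ordinary KZ calculus together imply `KontsevichZagierPeriods`.
[Kontsevich–Zagier 2001, §1.2, §4.3] [folklore] -/
theorem KZexp.kernelConjecture_and_conservative_imp
    (h : Literature.NumberTheory.Transcendental.KZexp.KernelConjecture ∧ Literature.NumberTheory.Transcendental.KZexp.Conservative) : KontsevichZagierPeriods :=
  Periods.kzKernelConjecture_imp (Literature.NumberTheory.Transcendental.KZexp.kzKernelConjecture_of_conservative h.2 h.1)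

end Literature
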